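import Summits.CriticalPhenomena.PercolationContinuityZ3.Theorems.Transplant.SkelPhiRootSched
import Summits.CriticalPhenomena.PercolationContinuityZ3.Theorems.Transplant.SkelPhiRootClauses
import HarnessLib

/-!
# D″ node, (R) layer — SCHEDULE-GENERIC form, part 2: THE KIT CLAUSES of ANY root schedule and the SCHEDULE-FREE FIRST HOP onto the
# landing ROW — `Skelφ.hkits_sched` (ONE call of p1-g9's `Skelφ.kitClause_stepI` per level of step `k` of `Sc : ChainPlanar.Schedule`, axis
# `Sc.ax k`, spreads `Sc.Wb k`, extents `[Sc.ℓ₀, Sc.ℓ₁]`, planar room = `WinChainData.roomS`; regions in the narrow between-box, off `Q 0`) and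
# `Skelφ.root_hsrc_row` (the Step-I′ side input at the wired walk's end over `rootCtr du (ca − ℓ1) 0` lands its side-half in the window over
# the ROW `sBox du.1 (sgOf du) (rootCtr du ca 0) (−0) 0 q'`; a root schedule whose core `0` holds that row takes it as its `B₀`) — the
# schedule-generic successors of file 6 (`SkelPhiRootClauses.hkits_rootSched / root_hsrc_stepI`, instance `RootRun2.rootSched`)

builds on p205010 (kernel theorem, internal audit signed; external expert review pending) — nothing in this file uses p205010.
Status sentence (coordinator 2026-08-20T04:30Z): "θ(p_c) = 0 on ℤ^d, all d ≥ 2 — kernel-verified (Lean 4/Mathlib, standard axioms); internal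
adversarial audit SIGNED 2026-08-20 04:29Z; external expert review pending."
Lane `prim-bschramm-*`, seat `prim-bschramm-p2` (gen 8; (R) = p2 lineage under D″); helper file (`--supports stmt-CriticalPhenomena-4575`).
* §1 **`Skelφ.hkits_sched`**;
* §2 **`Skelφ.root_hsrc_row`**.
[cite: KozmaNitzan2024, §4 Lemma 9 (p. 16), Lemma 10 Steps III–V (pp. 19–22), Lemma 11 (pp. 22–23), p. 28 ((32) at the root)]
-/

noncomputable section

open MeasureTheory ProbabilityTheory
open scoped ENNReal Classical

namespace Summit.CriticalPhenomena.PercolationContinuityZ3.Theorems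

namespace Transplant

namespace Skelφ

open Literature.Probability.Percolation Literature.Probability.LatticeModels SimpleGraph GadgetSystem ProbeHistory HSiteScheme Contour KNCells
open Literature.Probability.Percolation.KozmaNitzan
open Literature.Probability.Percolation.KozmaNitzan.Cells (oth oth_ne eq_oth_of_ne sgOf sgOf_sign)
open KNCells.KSchA KNLevels ChainPlanar
open Literature.Barriers.CriticalPhenomena (graphBall mem_graphBall_self graphBall_mono)
open BoxProdZ2 (ConcRadiiG rootCtr rootCtr_fst rootCtr_oth)
open Skel (winGraph)
open SkelI (tanOff)
open RootRun2 (mem_rootWorld_of_level)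

variable {V : Type} [DecidableEq V] {G : SimpleGraph V} [G.LocallyFinite] {φ : V → Site 2} {types : Finset V}
variable {P : PCells2} {w₀ : V} {Λ : ConcRadiiG} {q : unitInterval} {δc : ℝ} {Rt : ℕ} {du : MDir} {Sc : Schedule}

/-! ## §1 The kit clauses of a root schedule -/

/-- **THE KIT CLAUSES OF A ROOT SCHEDULE** (`hkits` of `Skelφ.rootOblS_concSG`, one direction): for `k ≤ Sc.N` and `j ∈ [j₀, j₁]`, the per-level
kit clause of the window step `k` of `(Sc, rootWCD … Sc … (rootUS …))` under the cut root law, from the Step-I′ certificate at the running density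
(threshold `1 − δ²`; the route extents `[Sc.ℓ₀, Sc.ℓ₁]` certified along the step's axis `Sc.ax k`, spreads `≤ Sc.Wb k`), p1-g9's kit / slab /
shell constants, the counts, `r₀ ≤ L' ≤ Rt`, and the planar facts of the schedule (regions in the narrow between-box, off `Q 0`).
[cite: KozmaNitzan2024, §4 Lemma 10 Steps III–V (pp. 19–22), Lemma 11 (pp. 22–23), p. 28] -/
theorem hkits_sched [Countable V] (hlip : Lip G φ) (hstep : Steps G φ) (hfr : Frames G φ types) (hκ : CylConn G φ types) {Δ : ℕ}
    (hΔ : ∀ v, G.degree v ≤ Δ) {p : unitInterval} (hC : CylSubcritical G φ types p)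
    (hreg : ∀ k ≤ Sc.N, Sc.region k ⊆ P.BtwN 0 du ∪ P.Q ((0 : Site 2) + stepVec du)) (hQ0 : ∀ k ≤ Sc.N, Disjoint (Sc.region k) (P.Q 0))
    (hRB : Rt + 1 ≤ Λ.rB 0 0 du) (hRQ : Rt + 1 ≤ Λ.rQ 0 ((0 : Site 2) + stepVec du))
    {Rlev j₀ j₁ : ℕ} (hRl : Rlev + 1 ≤ Sc.R') (hj : j₁ ≤ Rlev)
    -- the Step-I′ certificate at the running density `q`, threshold `1 − δ²`
    {D : StepI.Data V} {off : ℕ} (hD : D.Λ = fatSeqOff hfr hC off) {Sz Sx Sy : Finset ℕ} {δ : ℝ} (hδ : 0 < δ)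
    (hin : ∀ i ∈ StepI.index types Sz Sx Sy, 1 - δ ^ 2 < (bondPercolation G q).real (StepI.event G φ D i))
    -- the kit: zone scale, certified extents, half-widths, radii
    {Mz : ℕ} (hMz : Mz ∈ Sz) (hkz : D.k ≤ Mz) {ℓK : Fin 2 → ℕ} (hℓK0 : ∀ I, I = 0 → ℓK I ∈ Sx) (hℓK1 : ∀ I, I = 1 → ℓK I ∈ Sy)
    {A : Fin 2 → Fin 2 → ℕ} {Rk : Fin 2 → ℕ} (hAw : ∀ I, A I = StepI.widths D.Gb D.Fb I (ℓK I)) (hRk : ∀ I, Rk I = D.R (amax (A I)))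
    -- the slab and shell rooms of `kitClause'`, the level window above `T₀`, the near threshold inside the rim
    {ℓs M K Rsd r₀ rs cU L' : ℕ} (hℓs : 1 ≤ ℓs) (hj₀ : tanOff ℓs M ≤ j₀)
    (hA : ∀ i k, A i k ≤ M) (hAℓ : ∀ i, A i (oth i) ≤ ℓs) (hK : ∀ i, ℓs + 1 + A i i + Rk i ≤ K)
    (hnA : ∀ i, Mz + 1 ≤ A i i) (hnM : Mz ≤ M) (hρK : ∀ i, ℓs + 1 + A i i + (fatRadius hfr hC Mz + off) ≤ K)
    (hR'₁ : cylRadMax G φ types ℓs (ℓs + 2 + 2 * tanOff ℓs M) ≤ Rsd) (hR'₂ : ∀ i, cylRadMax G φ types ℓs (ℓs + 2 + A i i + Rk i) ≤ Rsd)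
    (hr₀₁ : ℓs + 1 + tanOff ℓs M + Rsd ≤ r₀) (hr₀₂ : ℓs + 2 + tanOff ℓs M + K ≤ r₀) (hr₀L : r₀ ≤ L') (hLR : L' ≤ Rt)
    (hrs₁ : ℓs + 2 + tanOff ℓs M + Rsd ≤ rs) (hrs₂ : ℓs + 2 + tanOff ℓs M + K ≤ rs) (hcU : ∀ i, (Δ + 1) ^ Rk i ≤ cU)
    -- the routes of the schedule: certified extents beyond the zone scale along each step's axis, depth, band spreads
    (hMℓ : Mz + 1 ≤ Sc.ℓ₀) (hSx : ∀ k ≤ Sc.N, Sc.ax k = 0 → ∀ ℓ, Sc.ℓ₀ ≤ ℓ → ℓ ≤ Sc.ℓ₁ → ℓ ∈ Sx)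
    (hSy : ∀ k ≤ Sc.N, Sc.ax k = 1 → ∀ ℓ, Sc.ℓ₀ ≤ ℓ → ℓ ≤ Sc.ℓ₁ → ℓ ∈ Sy)
    (hdepth : ∀ k ≤ Sc.N, ∀ I ℓ, Sc.ℓ₀ ≤ ℓ → ℓ ≤ Sc.ℓ₁ → 2 * ℓs + 2 + tanOff ℓs M + A I I + D.R (amax (StepI.widths D.Gb D.Fb (Sc.ax k) ℓ)) ≤ r₀)
    (hWb : ∀ k ≤ Sc.N, ∀ ℓ, Sc.ℓ₀ ≤ ℓ → ℓ ≤ Sc.ℓ₁ → StepI.widths D.Gb D.Fb (Sc.ax k) ℓ (oth (Sc.ax k)) ≤ Sc.Wb k ℓ)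
    -- the counts
    {Nc : ℕ} (kk : ℕ) (hN : kk * (Δ + 1) ^ (2 * rs) ≤ Nc)
    (hk : (1 - (q : ℝ) ^ (1 + Δ * ((Δ + 1) ^ Rsd + (tanOff ℓs M + 2)) + ((Δ + 1) ^ Rsd + (tanOff ℓs M + 2)) * cU)) ^ kk ≤ δ)
    -- the chain data
    (Pc : WinChainData V) (hPc : Pc = rootWCD G φ w₀ Rt L' Sc Rlev Nc j₀ j₁ (rootUS G φ P w₀ Λ q δc Rt du))
    {k : ℕ} (hkN : k ≤ Sc.N) {j : ℕ} (hjj : j ∈ Finset.Icc Pc.j₀ Pc.j₁) :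
    ∃ (σ : SData V) (Szz : Finset V),
      SHyp (Pc.stepL (planarWindowWin hlip w₀ Rt) Sc k) j σ ∧ σ.N ≤ Pc.N ∧
      (1 - (q : ℝ) ^ σ.sB) ^ σ.k ≤ δ ∧
      Szz ⊆ (Pc.stepL (planarWindowWin hlip w₀ Rt) Sc k).X j ∧ Szz ⊆ (planarWindowWin hlip w₀ Rt).stepD Sc k ∧
      (∀ x ∈ σ.K, ∀ e' ∈ σ.seed x, e' ∉ wireSet (↑Szz : Set V)) ∧ (∀ x ∈ σ.K, σ.face x ⊆ Szz) ∧
      (∀ x ∈ σ.K, 1 - 3 * δ ≤ (prodBernoulli ((⟨cellGeomSG G φ P w₀ Λ, q, δc⟩ : KSchA V ℕ).W0sub G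
          (rootUS G φ P w₀ Λ q δc Rt du))).real {ω | ∃ u ∈ σ.face x,
        1 - δ < (prodBernoulli (pinW ((⟨cellGeomSG G φ P w₀ Λ, q, δc⟩ : KSchA V ℕ).W0sub G (rootUS G φ P w₀ Λ q δc Rt du))
          (wireSet (↑Szz : Set V)) ω)).real
          (⋃ t' ∈ Pc.coreE (planarWindowWin hlip w₀ Rt) Sc k, openConnIn (↑((planarWindowWin hlip w₀ Rt).stepD Sc k) : Set V) u t')}) := by
  subst hPc
  set U' := rootUS G φ P w₀ Λ q δc Rt du with hU'
  set 𝒲 : PlanarWindow (winGraph G w₀ Rt) := planarWindowWin hlip w₀ Rt with h𝒲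
  set Pc := rootWCD G φ w₀ Rt L' Sc Rlev Nc j₀ j₁ U' with hPcdef
  change j ∈ Finset.Icc j₀ j₁ at hjj
  have hj₁ : j ≤ j₁ := (Finset.mem_Icc.1 hjj).2
  have hjT : tanOff ℓs M ≤ j := hj₀.trans (Finset.mem_Icc.1 hjj).1
  have hjR' : j ≤ Sc.R' := by omega
  have hR : r₀ ≤ Rt := hr₀L.trans hLR
  -- the levels of step `k` are the window levels over core `k`
  have hL : Pc.stepL 𝒲 Sc k = winLData G φ w₀ Rt (Sc.lo k) (Sc.hi k) w₀ U' := rfl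
  have hDreg : 𝒲.stepD Sc k = Win G φ w₀ (Sc.region k) Rt := rfl
  -- the region is a subbox of the window graph under the cut root law; the level lies in the region; the level box is wide
  have hWD : IsSubbox (winGraph G w₀ Rt) ((⟨cellGeomSG G φ P w₀ Λ, q, δc⟩ : KSchA V ℕ).W0sub G U') q (𝒲.stepD Sc k) := by
    rw [h𝒲]; exact isSubbox_sched hlip hstep hreg hQ0 hRB hRQ hkN
  have hXD : winLevel G φ w₀ Rt (Sc.lo k) (Sc.hi k) j ⊆ 𝒲.stepD Sc k := by
    rw [hDreg]; exact Win_mono G φ (Sc.level_subset_region hkN hjR') le_rfl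
  have hwide : ∀ i, (Sc.lo k - (j : Site 2)) i + 2 * tanOff ℓs M ≤ (Sc.hi k + (j : Site 2)) i := by
    intro i
    have hle := (Finset.nonempty_Icc.1 (Sc.core_nonempty (k := k) (by omega))) i
    have hj' : ((tanOff ℓs M : ℕ) : ℤ) ≤ j := by exact_mod_cast hjT
    simp only [Pi.sub_apply, Pi.add_apply, Pi.natCast_apply]
    linarith
  -- the enlarged target: true target over core (k+1), rim = the region's window vertices deeper than `Rt − L'`
  have hPT : Win G φ w₀ (Sc.core (k + 1)) Rt ⊆ Pc.coreE 𝒲 Sc k := Finset.subset_union_left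
  have hPD : Win G φ w₀ (Sc.region k) Rt ⊆ 𝒲.stepD Sc k := by rw [hDreg]
  have hfarT : ∀ x ∈ outerBoundary (winGraph G w₀ Rt) (winLevel G φ w₀ Rt (Sc.lo k) (Sc.hi k) j),
      inNbr G φ w₀ Rt (Finset.Icc (Sc.lo k - (j : Site 2)) (Sc.hi k + (j : Site 2))) x ∉ graphBall G w₀ (Rt - r₀) →
      inNbr G φ w₀ Rt (Finset.Icc (Sc.lo k - (j : Site 2)) (Sc.hi k + (j : Site 2))) x ∈ Pc.coreE 𝒲 Sc k := by
    intro x hx hfar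
    refine Finset.mem_union_right _ (Finset.mem_filter.2 ⟨?_, fun hB => hfar (graphBall_mono G w₀ (by omega) hB)⟩)
    exact Win_mono G φ (Sc.level_subset_region hkN hjR') le_rfl (inNbr_mem_Win hx)
  -- the planar room of the level: the schedule's route property
  have hroom := Pc.roomS Sc hRl hj hkN j hj₁
  rw [hL]
  exact kitClause_stepI hlip hstep hfr hκ hΔ hC hD hδ hin hMz hkz hℓK0 hℓK1 hAw hRk hℓs hwide hA hAℓ hK hnA hnM hρK hR'₁ hR'₂ hr₀₁ hr₀₂
    hR hrs₁ hrs₂ hcU (Sc.ax k) hMℓ (hSx k hkN) (hSy k hkN) (hdepth k hkN) (hWb k hkN) hroom kk w₀ U' hWD hXD hPD hPT hfarT hN hk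

/-! ## §2 The schedule-free first hop onto the landing row -/

/-- **THE FIRST HOP OF THE ROOT RUN ONTO THE LANDING ROW, FROM THE STEP-I′ CERTIFICATE** (direction `du`, schedule-free): the Step-I′ side
input `(c, ℓ1, some (du.1, sgOf du, +1))` at the end `c` of the wired walk over `x₀ = rootCtr du (ca − ℓ1) 0` (`ℓ1 ≤ min ca (5 r∥)`): its seed
`D.Λ c D.k ⊆ Win w₀ (P.Q 0) R₀` (`ca − ℓ1 + D.k ≤ 5 r∥`, `D.k ≤ 5 r⊥`, `5 r∥ + ψ(D.k) + off ≤ R₀`), its band rectangle inside the cut root world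
(`ca ≤ 25 r∥`, `Wb-width(ℓ1) ≤ q' ≤ 5 r⊥ − 1`, depth `5 r∥ + R(ℓ1) ≤ Rp`), its landing side-half in the window over the ROW
`sBox du.1 (sgOf du) (rootCtr du ca 0) (−0) 0 q' = {level = ca, |trans| ≤ q'}`.  Output: `∃ B₀ ⊆ Win w₀ ROW Rt, 1 − δ₁ < P_{W0sub (rootUS)}(⋃_{t ∈ B₀} w₀ ↔ t)`.
[cite: KozmaNitzan2024, §4 p. 28 ((32) at the root), Lemma 9 (p. 16), Lemma 11 (p. 23)] -/
theorem root_hsrc_row [Countable V] (hstep : Steps G φ) (hfr : Frames G φ types) {p : unitInterval} (hC : CylSubcritical G φ types p)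
    (hφ : φ w₀ = 0) {ca q' : ℤ} (hca25 : ca ≤ 25 * (P.r du.1 : ℤ)) (hq'5 : q' ≤ 5 * (P.r (oth du.1) : ℤ) - 1)
    -- the Step-I′ certificate at the running density `q`, threshold `1 − δ₁`
    {D : StepI.Data V} {off : ℕ} (hD : D.Λ = fatSeqOff hfr hC off) {Sz Sx Sy : Finset ℕ} {δ₁ : ℝ}
    (hin : ∀ i ∈ StepI.index types Sz Sx Sy, 1 - δ₁ < (bondPercolation G q).real (StepI.event G φ D i))
    -- the first-hop extent, certified along `du.1`, and its planar placement
    {ℓ1 : ℕ} (hℓ1x : du.1 = 0 → ℓ1 ∈ Sx) (hℓ1y : du.1 = 1 → ℓ1 ∈ Sy) (hℓ1ca : (ℓ1 : ℤ) ≤ ca) (hℓ1Q : (ℓ1 : ℤ) ≤ 5 * (P.r du.1 : ℤ))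
    (hcaQ : ca - ℓ1 + D.k ≤ 5 * (P.r du.1 : ℤ)) (hkQ : (D.k : ℤ) ≤ 5 * (P.r (oth du.1) : ℤ))
    (hW₁ : (StepI.widths D.Gb D.Fb du.1 ℓ1 (oth du.1) : ℤ) ≤ q')
    -- depths: the seed window, the band rectangle
    {R₀ Rp : ℕ} (hR₀ : 5 * P.r du.1 + (fatRadius hfr hC D.k + off) ≤ R₀) (hR₀Q : R₀ + 1 ≤ Λ.rQ 0 0) (hR₀t : R₀ ≤ Rt)
    (hRp : 5 * P.r du.1 + D.R (amax (StepI.widths D.Gb D.Fb du.1 ℓ1)) ≤ Rp) (hRpQ : Rp + 1 ≤ Λ.rQ 0 0) (hRpB : Rp + 1 ≤ Λ.rB 0 0 du)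
    (hRpQ' : Rp + 1 ≤ Λ.rQ 0 ((0 : Site 2) + stepVec du)) (hRpt : Rp ≤ Rt) :
    ∃ B₀ : Finset V, B₀ ⊆ Win G φ w₀ (sBox du.1 (sgOf du) (rootCtr du ca 0) (-0) 0 q') Rt ∧
      1 - δ₁ < (prodBernoulli ((⟨cellGeomSG G φ P w₀ Λ, q, δc⟩ : KSchA V ℕ).W0sub G (rootUS G φ P w₀ Λ q δc Rt du))).real
        (⋃ t ∈ B₀, openConn w₀ t) := by
  set S : KSchA V ℕ := ⟨cellGeomSG G φ P w₀ Λ, q, δc⟩ with hSdef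
  set U' := rootUS G φ P w₀ Λ q δc Rt du with hU'
  set aw : Fin 2 → ℕ := StepI.widths D.Gb D.Fb du.1 ℓ1 with haw
  set Rr : ℕ := D.R (amax aw) with hRr
  set x₀ : Site 2 := rootCtr du (ca - ℓ1) 0 with hx₀
  have hr0 : (0 : ℤ) ≤ P.r du.1 := by positivity
  have hr1 : (1 : ℤ) ≤ P.r (oth du.1) := by exact_mod_cast P.one_le_r (oth du.1)
  have hk0 : (0 : ℤ) ≤ D.k := by positivity
  have hσσ : sgOf du * sgOf du = 1 := by rcases sgOf_sign du with hs | hs <;> simp [hs]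
  -- the planar centre lies in the root cube, at ℓ¹-distance `ca − ℓ1 ≤ 5 r∥`
  have hx₀a : x₀ du.1 = sgOf du * (ca - ℓ1) := rootCtr_fst
  have hx₀b : x₀ (oth du.1) = 0 := rootCtr_oth
  have hx₀Q : x₀ ∈ P.Q 0 := by
    rw [PCells2.Q, PCells2.mem_abox_iff]
    intro i
    simp only [PCells2.cen_zero, Pi.zero_apply]
    push_cast
    by_cases hi : i = du.1
    · subst hi; rw [hx₀a]; rcases sgOf_sign du with hs | hs <;> rw [hs] <;> constructor <;> linarith
    · rw [eq_oth_of_ne hi, hx₀b]; constructor <;> linarith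
  have hnorm : (x₀ 0).natAbs + (x₀ 1).natAbs ≤ 5 * P.r du.1 := by
    have ha : (x₀ du.1).natAbs ≤ 5 * P.r du.1 := by
      have : |x₀ du.1| ≤ 5 * (P.r du.1 : ℤ) := by
        rw [hx₀a, abs_mul, (by rcases sgOf_sign du with hs | hs <;> simp [hs] : |sgOf du| = 1), one_mul, abs_le]
        constructor <;> linarith
      rw [← Int.natCast_natAbs] at this; exact_mod_cast this
    have hb : (x₀ (oth du.1)).natAbs = 0 := by rw [hx₀b]; rfl
    have key : (x₀ 0).natAbs + (x₀ 1).natAbs = (x₀ du.1).natAbs + (x₀ (oth du.1)).natAbs := by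
      rcases du with ⟨i, b⟩
      fin_cases i <;> simp [oth, Nat.add_comm]
    rw [key, hb, add_zero]; exact ha
  have hn : (x₀ 0).natAbs + (x₀ 1).natAbs ≤ R₀ := hnorm.trans (le_trans (Nat.le_add_right _ _) hR₀)
  have hWU : Win G φ w₀ (P.Q 0) R₀ ⊆ U' := Win_Q_subset_rootUS hstep hR₀Q hR₀t
  -- the input at any centre `c` over `x₀` within `‖x₀‖₁` of `w₀`: seed inside the root-cube window, band rectangle inside the cut root world
  have hlink : ∀ c, φ c = x₀ → c ∈ graphBall G w₀ ((x₀ 0).natAbs + (x₀ 1).natAbs) →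
      fatSeqOff hfr hC off c D.k ⊆ Win G φ w₀ (P.Q 0) R₀ ∧ rectPrismFin G φ c aw Rr ⊆ U' ∧
      1 - δ₁ < (bondPercolation G q).real (linkIn (↑(rectPrismFin G φ c aw Rr) : Set V) (fatSeqOff hfr hC off c D.k)
        (rhalf G φ c aw Rr du.1 (sgOf du) 1)) := by
    intro c hφc hcb
    have hcb' : c ∈ graphBall G w₀ (5 * P.r du.1) := graphBall_mono G w₀ hnorm hcb
    refine ⟨fun v hv => ?_, fun v hv => ?_, ?_⟩
    · -- the seed `fatSeqOff off c D.k` lies in the root-cube window of depth `R₀`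
      have hv' := cylBall_subset_prism G φ c _ _ ((mem_fatSeqOff_iff hfr hC off).1 hv)
      rw [mem_prism] at hv'
      obtain ⟨hvd, hvbox⟩ := hv'
      refine (mem_Win G φ).2 ⟨graphBall_mono G w₀ hR₀ (BoxProdZ2.mem_graphBall_add G hcb' hvd), ?_⟩
      rw [mem_box] at hvbox
      rw [PCells2.Q, PCells2.mem_abox_iff]
      intro i
      simp only [PCells2.cen_zero, Pi.zero_apply]
      push_cast
      have hvi := hvbox i
      simp only [Pi.sub_apply, hφc] at hvi
      by_cases hi : i = du.1
      · subst hi; rw [hx₀a] at hvi; rcases sgOf_sign du with hs | hs <;> rw [hs] at hvi <;> constructor <;> linarith [hvi.1, hvi.2]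
      · rw [eq_oth_of_ne hi] at hvi ⊢; rw [hx₀b] at hvi
        have hri : (P.r (oth du.1) : ℤ) ≤ P.r (oth du.1) := le_rfl
        constructor <;> linarith [hvi.1, hvi.2]
    · -- the band rectangle lies in the cut root world (levels `[ca − 2ℓ1, ca]`, `|trans| ≤ Wb ℓ1 ≤ 5 r⊥ − 1`, depth `≤ Rp`)
      rw [mem_rectPrismFin] at hv
      obtain ⟨hvc, hvr⟩ := (mem_rectPrism G φ).1 hv
      have hvd : v ∈ graphBall G c Rr := by
        have := cylBall_subset_prism G φ c _ _ hvc
        rw [mem_prism] at this; exact this.1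
      refine Win_rootWorld_subset_rootUS hstep hRpQ hRpB hRpQ' hRpt ((mem_Win G φ).2
        ⟨graphBall_mono G w₀ hRp (BoxProdZ2.mem_graphBall_add G hcb' hvd), ?_⟩)
      rw [mem_abox] at hvr
      have hva := hvr du.1
      have hvb := hvr (oth du.1)
      simp only [Pi.sub_apply, hφc, hx₀a, hx₀b, sub_zero, haw, StepI.widths_self] at hva hvb
      refine mem_rootWorld_of_level P du ?_ ?_ ?_
      · rcases sgOf_sign du with hs | hs <;> rw [hs] at hva ⊢ <;> linarith [hva.1, hva.2, hℓ1ca, hℓ1Q]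
      · rcases sgOf_sign du with hs | hs <;> rw [hs] at hva ⊢ <;> linarith [hva.1, hva.2, hℓ1ca, hca25]
      · have : |φ v (oth du.1)| ≤ (StepI.widths D.Gb D.Fb du.1 ℓ1 (oth du.1) : ℤ) := abs_le.2 ⟨by linarith [hvb.1], hvb.2⟩
        linarith
    · -- the link input at `c`, extent `ℓ1` along `du.1`, half `(sgOf du, +1)`
      obtain ⟨σu, hσu⟩ : ∃ σu : ℤˣ, (σu : ℤ) = sgOf du := by
        rcases sgOf_sign du with hs | hs
        · exact ⟨1, by simp [hs]⟩
        · exact ⟨-1, by simp [hs]⟩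
      have hev := link_at_center hfr hC hD hin c du.1 hℓ1x hℓ1y σu 1
      rw [hσu, Units.val_one, hD] at hev
      rw [coe_rectPrismFin]
      exact hev
  obtain ⟨c, hφc, hcb, hlt⟩ := root_hsrcSG hstep hfr hC P w₀ hφ q δc (U' := U') hx₀Q (le_trans (Nat.le_succ _) hR₀Q) hWU hn
    (off := off) (k := D.k) (δ := δ₁) (fun c => rectPrismFin G φ c aw Rr) (fun c => rhalf G φ c aw Rr du.1 (sgOf du) 1) hlink
  refine ⟨rhalf G φ c aw Rr du.1 (sgOf du) 1, fun w hw => ?_, hlt⟩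
  -- the landing side-half lies in the window over the start row `{level = ca, |trans| ≤ q'}`
  obtain ⟨hwP, hwa, hwb⟩ := (mem_rhalf G φ).1 hw
  have hwball : w ∈ graphBall G w₀ Rt := by
    have h1 : w ∈ graphBall G c Rr := rectPrism_subset_graphBall G φ c aw Rr hwP
    exact graphBall_mono G w₀ (le_trans (by omega) (hRp.trans hRpt)) (BoxProdZ2.mem_graphBall_add G (graphBall_mono G w₀ hnorm hcb) h1)
  refine (mem_Win G φ).2 ⟨hwball, ?_⟩
  rw [PCells.mem_psBox_iff]
  simp only [rootCtr_fst, rootCtr_oth]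
  have hwb' := abs_oth_le_of_mem_rside G φ ((mem_rside G φ).2 ⟨hwP, hwa⟩)
  rw [hφc, hx₀b, sub_zero] at hwb'
  rw [hφc, hx₀a, haw, StepI.widths_self] at hwa
  rw [one_mul, hφc, hx₀b, sub_zero] at hwb
  have hwb'' : |φ w (oth du.1)| ≤ q' := by
    refine le_trans ?_ hW₁
    rw [haw] at hwb'; exact_mod_cast hwb'
  refine ⟨?_, ?_⟩
  · have : sgOf du * (φ w du.1 - sgOf du * ca) = 0 := by
      have e1 : φ w du.1 = sgOf du * (ca - ℓ1) + sgOf du * ℓ1 := by linarith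
      rw [e1, show sgOf du * (ca - ↑ℓ1) + sgOf du * ↑ℓ1 - sgOf du * ca = 0 by ring, mul_zero]
    rw [this, neg_zero]; exact ⟨le_rfl, le_rfl⟩
  · rw [abs_le] at hwb''; constructor <;> linarith [hwb''.1, hwb''.2]


end Skelφ

end Transplant

end Summit.CriticalPhenomena.PercolationContinuityZ3.Theorems

end
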